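/-
Copyright: b2b-lace packet (literature seat, gen 11).  [FvdH17] §4.2: the SRW form of the extraction
bound (4.18) — its tail `p^M (a_M ⋆ τ_p)(x)` majorised by `(2dp)^M (D^{⋆M} ⋆ τ_p)(x)` ("bond-avoiding walks
are simple random walks that never use a bond twice") — and the last member of (4.3), over the tree objects
`tauGe` (`NobleBoundsN0`), `trailWordsTo` (`TrailCounts`), `srwStep`/`convPow`/`latticeConv`.
-/
import Literature.Probability.FitznerVanDerHofstad2017.TwoPointTrailExtraction
import Literature.Probability.FitznerVanDerHofstad2017.SrwLawBridges
import HarnessLib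

/-!
# [FvdH17] (4.18) with the simple-random-walk tail, and (4.3)

`TwoPointTrailExtraction.tauGe_le_trailExtraction` is [FvdH17] (4.18) as printed,
`τ_{n,p}(x) ≤ Σ_{r=n}^{M-1} p^r a_r(x) + p^M (a_M ⋆ τ_p)(x)`, with the tail written as a sum over the bond-avoiding
words `u ∈ trailWords d M` of `τ_p(x - u(M))`.  The sentence after (4.18) — "Bond-avoiding walks are simple random
walks that never use a bond twice" — is the majorisation `a_M ≤ (2d)^M D^{⋆M}` under which the tail becomes the
`(2dp)^M (D^{⋆M} ⋆ τ_p)(x)` of (4.3) and of [NoBLE17] (5.37)/(5.40); in the tree this is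
`trailWords d M ⊆ univ` followed by `SrwLawBridges.sum_words_eq_pow_mul_latticeConv`
(`Σ_{all words w} f(x - w(M)) = (2d)^M (D^{⋆M} ⋆ f)(x)`).

* `pow_mul_sum_trailWords_tau_le` : `p^M Σ_{u ∈ trailWords d M} τ_p(x - u(M)) ≤ (2dp)^M (D^{⋆M} ⋆ τ_p)(x)`;
* **`tauGe_le_trailExtraction_srw`** : `τ_{n,p}(x) ≤ Σ_{r ∈ [n,M)} p^r a_r(x) + (2dp)^M (D^{⋆M} ⋆ τ_p)(x)`
  (every `n, M, x, p`; for `M ≤ n` the explicit sum is empty);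
* **`tauGe_le_pow_mul_srwConv_tau`** : `τ_{m,p}(x) ≤ (2dp)^m (D^{⋆m} ⋆ τ_p)(x)` — the last member of (4.3)
  (PATH READING of `tauGe`; all `m ≥ 0` and all `x`, the printed side conditions `m ≥ 1`, `x ≠ 0` not needed).

The right-hand sides are the `latticeConv (convPow (srwStep d) M) (convPow (tau d p 0) 1)`-shaped objects that
`SimpleDiagramFourierBound.srwConvTau_le_printed` bounds by `Γ̄₂ K_{1,M}(x)`-type SRW integrals
(`convPow (tau d p 0) 1 = tau d p 0` by `convPow_one_eq`).

## References
* [FvdH17] R. Fitzner, R. van der Hofstad, Mean-field behavior for nearest-neighbor percolation in `d > 10`,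
  Electron. J. Probab. 22 (2017) no. 43; arXiv:1506.07977v2 — §4.2 (4.3), (4.18) and the sentence after it.
* [NoBLE17] R. Fitzner, R. van der Hofstad, Generalized approach to the non-backtracking lace expansion,
  Probab. Theory Relat. Fields 169 (2017) 1041–1119 — §5.3.1 (5.37), §5.3.2 (5.40) (the `(2dμ̄_z)^M (D^{⋆M} ⋆ G_z)`
  tails).
-/

noncomputable section

namespace Literature.Probability.FitznerVanDerHofstad2017

open Literature.Probability.Percolation
open Literature.Probability.LatticeModels
open Literature.Barriers.CriticalPhenomena
open Literature.Barriers.CriticalPhenomena.SpreadOutIsing (latticeConv convPow)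
open scoped BigOperators

variable {d : ℕ}

/-- A sum of non-negative terms over the bond-avoiding words is at most the sum over all words
(`a_M(x) ≤ #{M-step walks 0 → x}`). [cite: FitznerVanDerHofstad2017, §4.2, sentence after (4.18) arXiv:1506.07977v2 p. 36 = EJP p. 33] -/
theorem sum_trailWords_le_sum_univ (M : ℕ) {f : (Fin M → Fin d × Bool) → ℝ} (hf : ∀ w, 0 ≤ f w) :
    ∑ u ∈ trailWords d M, f u ≤ ∑ w : Fin M → Fin d × Bool, f w :=
  Finset.sum_le_univ_sum_of_nonneg hf

/-- **The tail of (4.18) in SRW form**: `p^M (a_M ⋆ τ_p)(x) ≤ (2dp)^M (D^{⋆M} ⋆ τ_p)(x)`, i.e.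
`p^M Σ_{u ∈ trailWords d M} τ_p(x - u(M)) ≤ (2dp)^M · latticeConv (convPow (srwStep d) M) (tau d p 0) x`.
[cite: FitznerVanDerHofstad2017, §4.2 (4.18) and the sentence after it arXiv:1506.07977v2 p. 36 = EJP p. 33]
[cite: FitznerVanDerHofstad2016NoBLE, §5.3.1 (5.37) PTRF p. 1097] -/
theorem pow_mul_sum_trailWords_tau_le (p : unitInterval) (M : ℕ) (x : Site d) :
    (p : ℝ) ^ M * ∑ u ∈ trailWords d M, tau d p 0 (x - wordPos u M) ≤
      (2 * d * (p : ℝ)) ^ M * latticeConv (convPow (srwStep d) M) (tau d p 0) x := by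
  rw [mul_pow, mul_comm ((2 * (d : ℝ)) ^ M), mul_assoc, ← sum_words_eq_pow_mul_latticeConv M (tau d p 0) x]
  exact mul_le_mul_of_nonneg_left (sum_trailWords_le_sum_univ M fun w => tau_nonneg p 0 _)
    (pow_nonneg p.2.1 M)

/-- **[FvdH17] (4.18) with the simple-random-walk tail**:
`τ_{n,p}(x) ≤ Σ_{r=n}^{M-1} p^r a_r(x) + (2dp)^M (D^{⋆M} ⋆ τ_p)(x)` (every `n, M`; PATH READING of `τ_{n,p}`).
[cite: FitznerVanDerHofstad2017, §4.2 (4.18) and the sentence after it arXiv:1506.07977v2 p. 36 = EJP p. 33]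
[cite: FitznerVanDerHofstad2016NoBLE, §5.3.1 (5.37) PTRF p. 1097] -/
theorem tauGe_le_trailExtraction_srw (p : unitInterval) (n M : ℕ) (x : Site d) :
    tauGe d p n x ≤ (∑ r ∈ Finset.Ico n M, (p : ℝ) ^ r * ((trailWordsTo d r x).card : ℝ)) +
      (2 * d * (p : ℝ)) ^ M * latticeConv (convPow (srwStep d) M) (tau d p 0) x :=
  (tauGe_le_trailExtraction p n M x).trans (by
    gcongr ?_ + ?_
    · exact le_rfl
    · exact pow_mul_sum_trailWords_tau_le p M x)

/-- **[FvdH17] (4.3), last member**: `τ_{m,p}(x) ≤ (2dp)^m (D^{⋆m} ⋆ τ_p)(x)` (PATH READING of `tauGe`; every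
`m ≥ 0` and every `x`). [cite: FitznerVanDerHofstad2017, §4.2 (4.3) arXiv:1506.07977v2 p. 34 = EJP p. 32] -/
theorem tauGe_le_pow_mul_srwConv_tau (p : unitInterval) (m : ℕ) (x : Site d) :
    tauGe d p m x ≤ (2 * d * (p : ℝ)) ^ m * latticeConv (convPow (srwStep d) m) (tau d p 0) x := by
  have h := tauGe_le_trailExtraction_srw p m m x
  rwa [Finset.Ico_self, Finset.sum_empty, zero_add] at h

end Literature.Probability.FitznerVanDerHofstad2017

end
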